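import Summits.RiemannHypothesis.RiemannHypothesis.Theorems.HandoffDodgerMoments
import Summits.RiemannHypothesis.RiemannHypothesis.Theorems.HandoffDodgerWitnessDefs
import HarnessLib

/-!
# HANDOFF — the POWER SUMS of the dodger configuration: realness-free SIZE bounds by counting (rh-explicit, track «HANDOFF», seat prove-2 gen10, ATTEMPT-19 §3)

HONEST FRAMING. Nothing here bears on the truth of RH; this is zero COUNTING (partial summation, `HandoffDodgerMoments`) and the
triangle inequality. At killing height `T` (`K = N(T)`, nodes `z_ρ = Im ρ + i(½ − Re ρ)` with multiplicity `m(ρ)` over `zerosBetween 0 T`,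
lattice `ν_k = ℓ_{k+1}² = (π(k+1)/b)²`) DEFINE the POWER SUMS

  `dodgerPowerSum b T j = S_j := Σ_ρ m(ρ)·(z_ρ²)^j − Σ_{k<K} ν_k^j`     (complex; `S_1 = p₁` is the first cumulant of ATTEMPT-16 §5),

and write `S_j⁰ := Σ_ρ m(ρ)·(Im ρ)^{2j} − Σ_{k<K} ℓ_{k+1}^{2j}` for the ORDINATE power sums (real). THEOREMS, all under the clean-horizon
hypothesis `N(t) ≤ Λ_K(t) := min(⌊bt/π⌋, K)` on `[0, T]` with `πK/b ≤ T` (the output of `HandoffDodgerHorizonGlue.count_sub_latticeCount_le_neg_taper`):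
(1) `S_j⁰ = ∫_0^T (Λ_K − N)·2j·t^{2j−1} dt`, hence **`0 ≤ S_j⁰ ≤ j·T^{2(j−1)}·S_1⁰`** (`ordinatePowerSum_nonneg`, `ordinatePowerSum_le`) — the
cumulant-quality cancellation between zeros and lattice WITHOUT enumerating or pairing zeros: `t^{2j−1} ≤ T^{2j−2}·t` under the integral;
and `S_1⁰ ≥ 2∫_0^T t·D(t)dt` when `N − Λ_K ≤ −D` (`ordinatePowerSum_one_ge`). (2) The off-line correction: `‖z_ρ² − (Im ρ)²‖ ≤ Im ρ + ¼`,
`‖z_ρ²‖ ≤ T² + ¼`, `‖a^j − c^j‖ ≤ j·W^{j−1}‖a − c‖` (`norm_pow_sub_pow_le`), so `‖S_j − S_j⁰‖ ≤ j(T²+¼)^{j−1}(T+¼)K` (`norm_dodgerPowerSum_sub_le`).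
(3) **`|Re S_1 − S_1⁰| ≤ K/4`**, `S_1⁰ − K/4 ≤ Re S_1 ≤ S_1⁰` (`re_dodgerPowerSum_one_ge/le`), and the packaged GEOMETRIC CUMULANT BOUND
**`‖S_j‖ ≤ j·W^{j−1}·P`** for every `j ≥ 1` with `W := T² + ¼`, `P := Re S_1 + K(T + ½)` (`norm_dodgerPowerSum_le_geometric`) — exactly the
hypothesis `hS` of `HandoffDodgerMajorant.norm_sub_le_of_geometric`. With `HandoffDodgerNewton` (realness `S_j ∈ ℝ`, `h = e^{−p₁X}·r`) this
closes the SIZE part of ATTEMPT-16's Lemma D1 up to the elementary three-range summation. No `sorry`, standard axioms; one definition.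

References: this track (ATTEMPT-16 §3 Lemma B3, §5 Lemma D1; ATTEMPT-18 §3 (δ′); ATTEMPT-19 §3).
-/

set_option linter.dupNamespace false

noncomputable section

open Complex Finset MeasureTheory intervalIntegral

namespace Summit.RiemannHypothesis.RiemannHypothesis.Theorems.Handoff

open Literature.NumberTheory.LFunctions Literature.NumberTheory.LFunctions.SchoenfeldBound
open scoped Real

/-- The POWER SUMS of the dodger configuration: `S_j = Σ_ρ m(ρ)·(z_ρ²)^j − Σ_{k<K} ((π(k+1)/b)²)^j`, `K = N(T)`.
[this track, ATTEMPT-16 §2 Lemma A3 (`j·p_j`); ATTEMPT-19 §1] -/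
def dodgerPowerSum (b T : ℝ) (j : ℕ) : ℂ :=
  ∑ ρ ∈ zerosBetween 0 T, ((riemannZetaZeroOrder ρ).toNat : ℂ) * (dodgerNode ρ ^ 2) ^ j -
    ∑ k ∈ Finset.range (zetaZeroCount T), ((((π * ((k + 1 : ℕ) : ℝ) / b) ^ 2 : ℝ)) : ℂ) ^ j

/-! ## The ordinate power sums (real): sign and size by counting -/

/-- `S_j⁰ ≥ 0` under the clean horizon `N ≤ Λ_K` on `[0, T]`. [this track, ATTEMPT-19 §3] -/
theorem ordinatePowerSum_nonneg {b T : ℝ} (hb : 0 < b) (hT : 0 ≤ T) (hK : π * (zetaZeroCount T) / b ≤ T)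
    (hΔ : ∀ t ∈ Set.Icc 0 T, (zetaZeroCount t : ℝ) - ((min ⌊b * t / π⌋₊ (zetaZeroCount T) : ℕ) : ℝ) ≤ 0) {j : ℕ} (hj : 1 ≤ j) :
    0 ≤ (∑ ρ ∈ zerosBetween 0 T, (riemannZetaZeroOrder ρ : ℝ) * ρ.im ^ (2 * j)) -
        ∑ k ∈ Finset.range (zetaZeroCount T), (π * ((k + 1 : ℕ) : ℝ) / b) ^ (2 * j) := by
  rw [sum_zeros_pow_sub_sum_lattice_pow hb hT (by omega) hK, ← intervalIntegral.integral_neg]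
  refine intervalIntegral.integral_nonneg hT fun t ht => ?_
  have hw : (0 : ℝ) ≤ ((2 * j : ℕ) : ℝ) * t ^ (2 * j - 1) := by have := ht.1; positivity
  have := hΔ t ht
  rw [← neg_mul]
  exact mul_nonneg (by linarith) hw

/-- **`S_j⁰ ≤ j·T^{2(j−1)}·S_1⁰`** under the clean horizon (`t^{2j−1} ≤ T^{2j−2}·t` under the counting integral).
[this track, ATTEMPT-19 §3] -/
theorem ordinatePowerSum_le {b T : ℝ} (hb : 0 < b) (hT : 0 ≤ T) (hK : π * (zetaZeroCount T) / b ≤ T)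
    (hΔ : ∀ t ∈ Set.Icc 0 T, (zetaZeroCount t : ℝ) - ((min ⌊b * t / π⌋₊ (zetaZeroCount T) : ℕ) : ℝ) ≤ 0) {j : ℕ} (hj : 1 ≤ j) :
    (∑ ρ ∈ zerosBetween 0 T, (riemannZetaZeroOrder ρ : ℝ) * ρ.im ^ (2 * j)) -
        ∑ k ∈ Finset.range (zetaZeroCount T), (π * ((k + 1 : ℕ) : ℝ) / b) ^ (2 * j) ≤
      (j : ℝ) * T ^ (2 * (j - 1)) *
        ((∑ ρ ∈ zerosBetween 0 T, (riemannZetaZeroOrder ρ : ℝ) * ρ.im ^ 2) -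
          ∑ k ∈ Finset.range (zetaZeroCount T), (π * ((k + 1 : ℕ) : ℝ) / b) ^ 2) := by
  have h2 := sum_zeros_pow_sub_sum_lattice_pow hb hT (show 1 ≤ 2 by norm_num) hK
  rw [sum_zeros_pow_sub_sum_lattice_pow hb hT (by omega) hK, h2, ← intervalIntegral.integral_neg,
    ← intervalIntegral.integral_neg, ← intervalIntegral.integral_const_mul]
  have hN : IntervalIntegrable (fun t : ℝ => (zetaZeroCount t : ℝ)) volume 0 T :=
    Monotone.intervalIntegrable fun s t hst => by exact_mod_cast zetaZeroCount_mono hst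
  have hΛ : IntervalIntegrable (fun t : ℝ => (((min ⌊b * t / π⌋₊ (zetaZeroCount T) : ℕ) : ℝ))) volume 0 T := by
    refine Monotone.intervalIntegrable fun s t hst => ?_
    exact_mod_cast min_le_min_right _ (Nat.floor_le_floor (by
      exact div_le_div_of_nonneg_right (mul_le_mul_of_nonneg_left hst hb.le) Real.pi_pos.le))
  have hg1 : Continuous fun t : ℝ => ((2 * j : ℕ) : ℝ) * t ^ (2 * j - 1) := by fun_prop
  have hg2 : Continuous fun t : ℝ => ((2 : ℕ) : ℝ) * t ^ (2 - 1) := by fun_prop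
  refine intervalIntegral.integral_mono_on hT ((hN.sub hΛ).mul_continuousOn hg1.continuousOn).neg
    (((hN.sub hΛ).mul_continuousOn hg2.continuousOn).neg.const_mul _) fun t ht => ?_
  have ht0 : 0 ≤ t := ht.1
  have hE : 0 ≤ -((zetaZeroCount t : ℝ) - ((min ⌊b * t / π⌋₊ (zetaZeroCount T) : ℕ) : ℝ)) := by
    have := hΔ t ht; linarith
  have hpow : t ^ (2 * j - 1) ≤ T ^ (2 * (j - 1)) * t := by
    rw [show 2 * j - 1 = 2 * (j - 1) + 1 by omega, pow_succ]
    exact mul_le_mul_of_nonneg_right (pow_le_pow_left₀ ht0 ht.2 _) ht0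
  have key : ((2 * j : ℕ) : ℝ) * t ^ (2 * j - 1) ≤ (j : ℝ) * T ^ (2 * (j - 1)) * (((2 : ℕ) : ℝ) * t ^ (2 - 1)) := by
    rw [show (2 : ℕ) - 1 = 1 from rfl, pow_one]
    push_cast
    nlinarith
  calc -(((zetaZeroCount t : ℝ) - ((min ⌊b * t / π⌋₊ (zetaZeroCount T) : ℕ) : ℝ)) * (((2 * j : ℕ) : ℝ) * t ^ (2 * j - 1)))
      = -((zetaZeroCount t : ℝ) - ((min ⌊b * t / π⌋₊ (zetaZeroCount T) : ℕ) : ℝ)) * (((2 * j : ℕ) : ℝ) * t ^ (2 * j - 1)) := by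
        ring
    _ ≤ -((zetaZeroCount t : ℝ) - ((min ⌊b * t / π⌋₊ (zetaZeroCount T) : ℕ) : ℝ)) *
          ((j : ℝ) * T ^ (2 * (j - 1)) * (((2 : ℕ) : ℝ) * t ^ (2 - 1))) := mul_le_mul_of_nonneg_left key hE
    _ = (j : ℝ) * T ^ (2 * (j - 1)) *
          -(((zetaZeroCount t : ℝ) - ((min ⌊b * t / π⌋₊ (zetaZeroCount T) : ℕ) : ℝ)) * (((2 : ℕ) : ℝ) * t ^ (2 - 1))) := by
        ring

/-- **`S_1⁰ ≥ 2∫_0^T t·D(t)dt`** when `N − Λ_K ≤ −D` on `[0, T]` (`D` continuous): the first cumulant is at least twice the deficit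
integral of the cost theorem. [this track, ATTEMPT-16 Lemma B2; ATTEMPT-19 §3] -/
theorem ordinatePowerSum_one_ge {b T : ℝ} (hb : 0 < b) (hT : 0 ≤ T) (hK : π * (zetaZeroCount T) / b ≤ T)
    {D : ℝ → ℝ} (hD : ContinuousOn D (Set.Icc 0 T))
    (hΔ : ∀ t ∈ Set.Icc 0 T, (zetaZeroCount t : ℝ) - ((min ⌊b * t / π⌋₊ (zetaZeroCount T) : ℕ) : ℝ) ≤ -D t) :
    2 * ∫ t in (0 : ℝ)..T, t * D t ≤
      (∑ ρ ∈ zerosBetween 0 T, (riemannZetaZeroOrder ρ : ℝ) * ρ.im ^ 2) -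
        ∑ k ∈ Finset.range (zetaZeroCount T), (π * ((k + 1 : ℕ) : ℝ) / b) ^ 2 := by
  rw [sum_zeros_pow_sub_sum_lattice_pow hb hT (show 1 ≤ 2 by norm_num) hK, ← intervalIntegral.integral_neg,
    ← intervalIntegral.integral_const_mul]
  have hN : IntervalIntegrable (fun t : ℝ => (zetaZeroCount t : ℝ)) volume 0 T :=
    Monotone.intervalIntegrable fun s t hst => by exact_mod_cast zetaZeroCount_mono hst
  have hΛ : IntervalIntegrable (fun t : ℝ => (((min ⌊b * t / π⌋₊ (zetaZeroCount T) : ℕ) : ℝ))) volume 0 T := by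
    refine Monotone.intervalIntegrable fun s t hst => ?_
    exact_mod_cast min_le_min_right _ (Nat.floor_le_floor (by
      exact div_le_div_of_nonneg_right (mul_le_mul_of_nonneg_left hst hb.le) Real.pi_pos.le))
  have hg2 : Continuous fun t : ℝ => ((2 : ℕ) : ℝ) * t ^ (2 - 1) := by fun_prop
  have hDi : IntervalIntegrable (fun t : ℝ => 2 * (t * D t)) volume 0 T :=
    (((continuousOn_id).mul hD).intervalIntegrable_of_Icc hT).const_mul 2
  refine intervalIntegral.integral_mono_on hT hDi ((hN.sub hΛ).mul_continuousOn hg2.continuousOn).neg fun t ht => ?_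
  have ht0 : 0 ≤ t := ht.1
  have := hΔ t ht
  rw [show (2 : ℕ) - 1 = 1 from rfl, pow_one, show ((2 : ℕ) : ℝ) = 2 by norm_num]
  nlinarith [mul_le_mul_of_nonneg_right this ht0]

/-! ## Nodes versus ordinates -/

/-- `‖a^j − c^j‖ ≤ j·W^{j−1}·‖a − c‖` when `‖a‖, ‖c‖ ≤ W`. [folklore] -/
theorem norm_pow_sub_pow_le {a c : ℂ} {W : ℝ} (ha : ‖a‖ ≤ W) (hc : ‖c‖ ≤ W) (j : ℕ) :
    ‖a ^ j - c ^ j‖ ≤ (j : ℝ) * W ^ (j - 1) * ‖a - c‖ := by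
  have hW : 0 ≤ W := (norm_nonneg _).trans ha
  have h := (Commute.all a c).geom_sum₂_mul j
  rw [← h, norm_mul]
  refine mul_le_mul_of_nonneg_right ?_ (norm_nonneg _)
  refine (norm_sum_le _ _).trans ?_
  have hterm : ∀ i ∈ Finset.range j, ‖a ^ i * c ^ (j - 1 - i)‖ ≤ W ^ (j - 1) := by
    intro i hi
    have hi' := Finset.mem_range.1 hi
    have hsplit : W ^ (j - 1) = W ^ i * W ^ (j - 1 - i) := by
      rw [← pow_add]; congr 1; omega
    rw [norm_mul, norm_pow, norm_pow, hsplit]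
    exact mul_le_mul (pow_le_pow_left₀ (norm_nonneg _) ha _) (pow_le_pow_left₀ (norm_nonneg _) hc _)
      (by positivity) (by positivity)
  refine (Finset.sum_le_sum hterm).trans ?_
  rw [Finset.sum_const, Finset.card_range, nsmul_eq_mul]

/-- For `ρ` in the closed critical strip: `‖z_ρ² − (Im ρ)²‖ ≤ Im ρ + ¼` (`z_ρ = Im ρ + iη`, `|η| ≤ ½`). [this track, ATTEMPT-16 Lemma B3 (i)] -/
theorem norm_dodgerNode_sq_sub_le {ρ : ℂ} (h0 : 0 ≤ ρ.re) (h1 : ρ.re ≤ 1) (him : 0 ≤ ρ.im) :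
    ‖dodgerNode ρ ^ 2 - ((ρ.im : ℝ) : ℂ) ^ 2‖ ≤ ρ.im + 1 / 4 := by
  have hη := abs_im_dodgerNode_le h0 h1
  have hre : (dodgerNode ρ).re = ρ.im := by simp [dodgerNode]
  set η := (dodgerNode ρ).im with hηdef
  have hz : dodgerNode ρ = ((ρ.im : ℝ) : ℂ) + ((η : ℝ) : ℂ) * I :=
    Complex.ext (by simp [dodgerNode]) (by simp [hηdef])
  have e : dodgerNode ρ ^ 2 - ((ρ.im : ℝ) : ℂ) ^ 2 = (((η : ℝ) : ℂ) * I) * (2 * ((ρ.im : ℝ) : ℂ) + ((η : ℝ) : ℂ) * I) := by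
    rw [hz]; ring
  rw [e, norm_mul, norm_mul, Complex.norm_real, Complex.norm_I, mul_one, Real.norm_eq_abs]
  have h2 : ‖2 * ((ρ.im : ℝ) : ℂ) + ((η : ℝ) : ℂ) * I‖ ≤ 2 * ρ.im + 1 / 2 := by
    refine (norm_add_le _ _).trans ?_
    have e1 : ‖(2 : ℂ) * ((ρ.im : ℝ) : ℂ)‖ = 2 * ρ.im := by
      rw [norm_mul, Complex.norm_real, Real.norm_eq_abs, abs_of_nonneg him, Complex.norm_two]
    have e2 : ‖((η : ℝ) : ℂ) * I‖ = |η| := by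
      rw [norm_mul, Complex.norm_I, mul_one, Complex.norm_real, Real.norm_eq_abs]
    rw [e1, e2]
    linarith
  calc |η| * ‖2 * ((ρ.im : ℝ) : ℂ) + ((η : ℝ) : ℂ) * I‖ ≤ (1 / 2) * (2 * ρ.im + 1 / 2) :=
        mul_le_mul hη h2 (norm_nonneg _) (by norm_num)
    _ = ρ.im + 1 / 4 := by ring

/-- For a killed zero (`0 < Im ρ ≤ T`): `‖z_ρ²‖ ≤ T² + ¼`. [this track, ATTEMPT-16 §1 (`T₂`)] -/
theorem norm_dodgerNode_sq_le {ρ : ℂ} {T : ℝ} (h0 : 0 ≤ ρ.re) (h1 : ρ.re ≤ 1) (him : 0 ≤ ρ.im) (hT : ρ.im ≤ T) :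
    ‖dodgerNode ρ ^ 2‖ ≤ T ^ 2 + 1 / 4 := by
  have hη := abs_im_dodgerNode_le h0 h1
  have hre : (dodgerNode ρ).re = ρ.im := by simp [dodgerNode]
  rw [norm_pow, ← Complex.normSq_eq_norm_sq, Complex.normSq_apply, hre]
  have h1' : ρ.im * ρ.im ≤ T ^ 2 := by rw [sq]; exact mul_self_le_mul_self him hT
  have h2' : (dodgerNode ρ).im * (dodgerNode ρ).im ≤ 1 / 4 := by
    have := abs_le.1 hη
    nlinarith
  linarith

/-- The total multiplicity of the killed multiset is `K = N(T)` (real form). [this track, ATTEMPT-18 (D-2)] -/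
theorem sum_zeroOrder_toNat_cast_eq (T : ℝ) :
    ∑ ρ ∈ zerosBetween 0 T, ((riemannZetaZeroOrder ρ).toNat : ℝ) = (zetaZeroCount T : ℝ) := by
  have h := sum_zeroOrder_toNat_eq T
  exact_mod_cast h

/-- `(m(ρ).toNat : ℝ) = m(ρ)` on the killed multiset. [folklore] -/
theorem zeroOrder_toNat_cast {T : ℝ} {ρ : ℂ} (hρ : ρ ∈ zerosBetween 0 T) :
    ((riemannZetaZeroOrder ρ).toNat : ℝ) = (riemannZetaZeroOrder ρ : ℝ) := by
  have h0 : 0 ≤ riemannZetaZeroOrder ρ := by exact_mod_cast zeroOrder_nonneg_of_mem_zerosBetween le_rfl hρ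
  have : ((riemannZetaZeroOrder ρ).toNat : ℤ) = riemannZetaZeroOrder ρ := Int.toNat_of_nonneg h0
  exact_mod_cast this

/-- `(m(ρ).toNat : ℂ) = m(ρ)` on the killed multiset. [folklore] -/
theorem zeroOrder_toNat_castC {T : ℝ} {ρ : ℂ} (hρ : ρ ∈ zerosBetween 0 T) :
    ((riemannZetaZeroOrder ρ).toNat : ℂ) = ((riemannZetaZeroOrder ρ : ℤ) : ℂ) := by
  have h0 : 0 ≤ riemannZetaZeroOrder ρ := by exact_mod_cast zeroOrder_nonneg_of_mem_zerosBetween le_rfl hρ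
  have : ((riemannZetaZeroOrder ρ).toNat : ℤ) = riemannZetaZeroOrder ρ := Int.toNat_of_nonneg h0
  exact_mod_cast this

/-- **Nodes versus ordinates**: `‖S_j − S_j⁰‖ ≤ j·(T²+¼)^{j−1}·(T+¼)·K`. [this track, ATTEMPT-16 Lemma B3 (i); ATTEMPT-19 §3] -/
theorem norm_dodgerPowerSum_sub_le (b T : ℝ) (j : ℕ) :
    ‖dodgerPowerSum b T j -
        ((((∑ ρ ∈ zerosBetween 0 T, (riemannZetaZeroOrder ρ : ℝ) * ρ.im ^ (2 * j)) -
          ∑ k ∈ Finset.range (zetaZeroCount T), (π * ((k + 1 : ℕ) : ℝ) / b) ^ (2 * j) : ℝ)) : ℂ)‖ ≤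
      (j : ℝ) * (T ^ 2 + 1 / 4) ^ (j - 1) * (T + 1 / 4) * (zetaZeroCount T : ℝ) := by
  -- the lattice parts cancel; the zero parts differ by `Σ_ρ m((z_ρ²)^j − ((Im ρ)²)^j)`
  have hL : ∑ k ∈ Finset.range (zetaZeroCount T), ((((π * ((k + 1 : ℕ) : ℝ) / b) ^ 2 : ℝ)) : ℂ) ^ j =
      (((∑ k ∈ Finset.range (zetaZeroCount T), (π * ((k + 1 : ℕ) : ℝ) / b) ^ (2 * j) : ℝ)) : ℂ) := by
    push_cast
    exact Finset.sum_congr rfl fun k _ => by rw [← pow_mul]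
  have hA : (((∑ ρ ∈ zerosBetween 0 T, (riemannZetaZeroOrder ρ : ℝ) * ρ.im ^ (2 * j) : ℝ)) : ℂ) =
      ∑ ρ ∈ zerosBetween 0 T, ((riemannZetaZeroOrder ρ).toNat : ℂ) * (((ρ.im : ℝ) : ℂ) ^ 2) ^ j := by
    push_cast
    refine Finset.sum_congr rfl fun ρ hρ => ?_
    rw [zeroOrder_toNat_castC hρ, ← pow_mul]
  have e : dodgerPowerSum b T j -
      ((((∑ ρ ∈ zerosBetween 0 T, (riemannZetaZeroOrder ρ : ℝ) * ρ.im ^ (2 * j)) -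
        ∑ k ∈ Finset.range (zetaZeroCount T), (π * ((k + 1 : ℕ) : ℝ) / b) ^ (2 * j) : ℝ)) : ℂ) =
      ∑ ρ ∈ zerosBetween 0 T, ((riemannZetaZeroOrder ρ).toNat : ℂ) * ((dodgerNode ρ ^ 2) ^ j - (((ρ.im : ℝ) : ℂ) ^ 2) ^ j) := by
    rw [dodgerPowerSum, hL, Complex.ofReal_sub, hA, sub_sub_sub_cancel_right, ← Finset.sum_sub_distrib]
    exact Finset.sum_congr rfl fun ρ _ => by ring
  rw [e]
  have hterm : ∀ ρ ∈ zerosBetween 0 T,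
      ‖((riemannZetaZeroOrder ρ).toNat : ℂ) * ((dodgerNode ρ ^ 2) ^ j - (((ρ.im : ℝ) : ℂ) ^ 2) ^ j)‖ ≤
        ((riemannZetaZeroOrder ρ).toNat : ℝ) * ((j : ℝ) * (T ^ 2 + 1 / 4) ^ (j - 1) * (T + 1 / 4)) := by
    intro ρ hρ
    obtain ⟨_, h0, h1, him, hle⟩ := (mem_zerosBetween le_rfl).1 hρ
    rw [norm_mul, Complex.norm_natCast]
    refine mul_le_mul_of_nonneg_left ?_ (Nat.cast_nonneg _)
    have ha : ‖dodgerNode ρ ^ 2‖ ≤ T ^ 2 + 1 / 4 := norm_dodgerNode_sq_le h0 h1 him.le hle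
    have hc : ‖((ρ.im : ℝ) : ℂ) ^ 2‖ ≤ T ^ 2 + 1 / 4 := by
      rw [norm_pow, Complex.norm_real, Real.norm_eq_abs, abs_of_nonneg him.le]
      nlinarith [pow_le_pow_left₀ him.le hle 2]
    refine (norm_pow_sub_pow_le ha hc j).trans ?_
    refine mul_le_mul_of_nonneg_left ((norm_dodgerNode_sq_sub_le h0 h1 him.le).trans (by linarith)) (by positivity)
  refine (norm_sum_le _ _).trans ((Finset.sum_le_sum hterm).trans ?_)
  rw [← Finset.sum_mul, sum_zeroOrder_toNat_cast_eq]
  exact le_of_eq (by ring)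

/-! ## The first cumulant `p₁ = Re S_1` and the geometric bound -/

/-- `S_1⁰ − K/4 ≤ Re S_1` (`Re z_ρ² = (Im ρ)² − η² ≥ (Im ρ)² − ¼`). [this track, ATTEMPT-16 §1 (`p₁ ∈ [D₁ − K/4, D₁]`)] -/
theorem re_dodgerPowerSum_one_ge {b T : ℝ} :
    ((∑ ρ ∈ zerosBetween 0 T, (riemannZetaZeroOrder ρ : ℝ) * ρ.im ^ 2) -
        ∑ k ∈ Finset.range (zetaZeroCount T), (π * ((k + 1 : ℕ) : ℝ) / b) ^ 2) - (zetaZeroCount T : ℝ) / 4 ≤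
      (dodgerPowerSum b T 1).re := by
  rw [dodgerPowerSum, Complex.sub_re, Complex.re_sum, Complex.re_sum]
  have hz : ∀ ρ ∈ zerosBetween 0 T,
      (riemannZetaZeroOrder ρ : ℝ) * ρ.im ^ 2 - ((riemannZetaZeroOrder ρ).toNat : ℝ) / 4 ≤
        ((((riemannZetaZeroOrder ρ).toNat : ℂ) * (dodgerNode ρ ^ 2) ^ 1)).re := by
    intro ρ hρ
    obtain ⟨_, h0, h1, _, _⟩ := (mem_zerosBetween le_rfl).1 hρ
    have hη := abs_le.1 (abs_im_dodgerNode_le h0 h1)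
    have hre : (dodgerNode ρ).re = ρ.im := by simp [dodgerNode]
    have hm0 : 0 ≤ (riemannZetaZeroOrder ρ : ℝ) := by rw [← zeroOrder_toNat_cast hρ]; exact Nat.cast_nonneg _
    have hzre : (dodgerNode ρ ^ 2).re = ρ.im ^ 2 - (dodgerNode ρ).im ^ 2 := by rw [sq, Complex.mul_re, hre]; ring
    have him2 : (dodgerNode ρ).im ^ 2 ≤ 1 / 4 := by nlinarith [hη.1, hη.2]
    rw [pow_one, show ((riemannZetaZeroOrder ρ).toNat : ℂ) = (((riemannZetaZeroOrder ρ).toNat : ℝ) : ℂ) by norm_cast,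
      Complex.re_ofReal_mul, zeroOrder_toNat_cast hρ, hzre]
    nlinarith [mul_nonneg hm0 (sub_nonneg.2 him2)]
  have hk : ∀ k ∈ Finset.range (zetaZeroCount T),
      (((((π * ((k + 1 : ℕ) : ℝ) / b) ^ 2 : ℝ)) : ℂ) ^ 1).re = (π * ((k + 1 : ℕ) : ℝ) / b) ^ 2 := by
    intro k _
    rw [pow_one, Complex.ofReal_re]
  rw [Finset.sum_congr rfl hk]
  have h1 := Finset.sum_le_sum hz
  rw [Finset.sum_sub_distrib, ← Finset.sum_div, sum_zeroOrder_toNat_cast_eq] at h1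
  linarith

/-- `Re S_1 ≤ S_1⁰`. [this track, ATTEMPT-16 §1] -/
theorem re_dodgerPowerSum_one_le {b T : ℝ} :
    (dodgerPowerSum b T 1).re ≤
      (∑ ρ ∈ zerosBetween 0 T, (riemannZetaZeroOrder ρ : ℝ) * ρ.im ^ 2) -
        ∑ k ∈ Finset.range (zetaZeroCount T), (π * ((k + 1 : ℕ) : ℝ) / b) ^ 2 := by
  rw [dodgerPowerSum, Complex.sub_re, Complex.re_sum, Complex.re_sum]
  have hz : ∀ ρ ∈ zerosBetween 0 T,
      ((((riemannZetaZeroOrder ρ).toNat : ℂ) * (dodgerNode ρ ^ 2) ^ 1)).re ≤ (riemannZetaZeroOrder ρ : ℝ) * ρ.im ^ 2 := by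
    intro ρ hρ
    have hre : (dodgerNode ρ).re = ρ.im := by simp [dodgerNode]
    have hm0 : 0 ≤ (riemannZetaZeroOrder ρ : ℝ) := by rw [← zeroOrder_toNat_cast hρ]; exact Nat.cast_nonneg _
    have hzre : (dodgerNode ρ ^ 2).re = ρ.im ^ 2 - (dodgerNode ρ).im ^ 2 := by rw [sq, Complex.mul_re, hre]; ring
    rw [pow_one, show ((riemannZetaZeroOrder ρ).toNat : ℂ) = (((riemannZetaZeroOrder ρ).toNat : ℝ) : ℂ) by norm_cast,
      Complex.re_ofReal_mul, zeroOrder_toNat_cast hρ, hzre]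
    nlinarith [mul_nonneg hm0 (sq_nonneg (dodgerNode ρ).im)]
  have hk : ∀ k ∈ Finset.range (zetaZeroCount T),
      (((((π * ((k + 1 : ℕ) : ℝ) / b) ^ 2 : ℝ)) : ℂ) ^ 1).re = (π * ((k + 1 : ℕ) : ℝ) / b) ^ 2 := by
    intro k _
    rw [pow_one, Complex.ofReal_re]
  rw [Finset.sum_congr rfl hk]
  linarith [Finset.sum_le_sum hz]

/-- **`p₁ ≥ 2∫_0^T t·D − K/4`**: the lower bound for the first cumulant from the clean-horizon deficit. [this track, ATTEMPT-16 Lemma B2; ATTEMPT-19 §3] -/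
theorem re_dodgerPowerSum_one_ge_integral {b T : ℝ} (hb : 0 < b) (hT : 0 ≤ T) (hK : π * (zetaZeroCount T) / b ≤ T)
    {D : ℝ → ℝ} (hD : ContinuousOn D (Set.Icc 0 T))
    (hΔ : ∀ t ∈ Set.Icc 0 T, (zetaZeroCount t : ℝ) - ((min ⌊b * t / π⌋₊ (zetaZeroCount T) : ℕ) : ℝ) ≤ -D t) :
    2 * (∫ t in (0 : ℝ)..T, t * D t) - (zetaZeroCount T : ℝ) / 4 ≤ (dodgerPowerSum b T 1).re := by
  have h1 := ordinatePowerSum_one_ge hb hT hK hD hΔ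
  have h2 := re_dodgerPowerSum_one_ge (b := b) (T := T)
  linarith

/-- **The geometric cumulant bound**: under the clean horizon, for every `j ≥ 1`,
`‖S_j‖ ≤ j·W^{j−1}·P` with `W = T² + ¼`, `P = Re S_1 + K(T + ½)` — hypothesis `hS` of `HandoffDodgerMajorant.norm_sub_le_of_geometric`.
[this track, ATTEMPT-16 Lemma B3; ATTEMPT-19 §3] -/
theorem norm_dodgerPowerSum_le_geometric {b T : ℝ} (hb : 0 < b) (hT : 0 ≤ T) (hK : π * (zetaZeroCount T) / b ≤ T)
    (hΔ : ∀ t ∈ Set.Icc 0 T, (zetaZeroCount t : ℝ) - ((min ⌊b * t / π⌋₊ (zetaZeroCount T) : ℕ) : ℝ) ≤ 0) {j : ℕ} (hj : 1 ≤ j) :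
    ‖dodgerPowerSum b T j‖ ≤
      (j : ℝ) * (T ^ 2 + 1 / 4) ^ (j - 1) * ((dodgerPowerSum b T 1).re + (zetaZeroCount T : ℝ) * (T + 1 / 2)) := by
  set S0j := (∑ ρ ∈ zerosBetween 0 T, (riemannZetaZeroOrder ρ : ℝ) * ρ.im ^ (2 * j)) -
    ∑ k ∈ Finset.range (zetaZeroCount T), (π * ((k + 1 : ℕ) : ℝ) / b) ^ (2 * j) with hS0j
  set S01 := (∑ ρ ∈ zerosBetween 0 T, (riemannZetaZeroOrder ρ : ℝ) * ρ.im ^ 2) -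
    ∑ k ∈ Finset.range (zetaZeroCount T), (π * ((k + 1 : ℕ) : ℝ) / b) ^ 2 with hS01
  have hdiff := norm_dodgerPowerSum_sub_le b T j
  have h0 : 0 ≤ S0j := ordinatePowerSum_nonneg hb hT hK hΔ hj
  have hle : S0j ≤ (j : ℝ) * T ^ (2 * (j - 1)) * S01 := ordinatePowerSum_le hb hT hK hΔ hj
  have h01 : 0 ≤ S01 := by
    have := ordinatePowerSum_nonneg hb hT hK hΔ (le_refl 1)
    simp only [mul_one] at this
    exact this
  have hre := re_dodgerPowerSum_one_ge (b := b) (T := T)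
  have hW : T ^ (2 * (j - 1)) ≤ (T ^ 2 + 1 / 4) ^ (j - 1) := by
    rw [pow_mul]
    exact pow_le_pow_left₀ (sq_nonneg T) (by linarith) _
  have hK0 : (0 : ℝ) ≤ zetaZeroCount T := Nat.cast_nonneg _
  -- `‖S_j‖ ≤ ‖S_j⁰‖ + off ≤ jT^{2(j−1)}S_1⁰ + jW^{j−1}(T+¼)K ≤ jW^{j−1}(S_1⁰ + (T+¼)K) ≤ jW^{j−1}(Re S_1 + K/4 + (T+¼)K)`
  have h1 : ‖dodgerPowerSum b T j‖ ≤ S0j + (j : ℝ) * (T ^ 2 + 1 / 4) ^ (j - 1) * (T + 1 / 4) * (zetaZeroCount T : ℝ) := by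
    have hn : ‖((S0j : ℝ) : ℂ)‖ = S0j := by rw [Complex.norm_real, Real.norm_eq_abs, abs_of_nonneg h0]
    calc ‖dodgerPowerSum b T j‖ = ‖(dodgerPowerSum b T j - ((S0j : ℝ) : ℂ)) + ((S0j : ℝ) : ℂ)‖ := by rw [sub_add_cancel]
      _ ≤ ‖dodgerPowerSum b T j - ((S0j : ℝ) : ℂ)‖ + ‖((S0j : ℝ) : ℂ)‖ := norm_add_le _ _
      _ ≤ (j : ℝ) * (T ^ 2 + 1 / 4) ^ (j - 1) * (T + 1 / 4) * (zetaZeroCount T : ℝ) + S0j := add_le_add hdiff hn.le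
      _ = S0j + (j : ℝ) * (T ^ 2 + 1 / 4) ^ (j - 1) * (T + 1 / 4) * (zetaZeroCount T : ℝ) := add_comm _ _
  have hjW : (0 : ℝ) ≤ (j : ℝ) * (T ^ 2 + 1 / 4) ^ (j - 1) := by positivity
  have hA : (j : ℝ) * T ^ (2 * (j - 1)) * S01 ≤ (j : ℝ) * (T ^ 2 + 1 / 4) ^ (j - 1) * S01 :=
    mul_le_mul_of_nonneg_right (mul_le_mul_of_nonneg_left hW (Nat.cast_nonneg j)) h01
  have hB : S01 ≤ (dodgerPowerSum b T 1).re + (zetaZeroCount T : ℝ) / 4 := by linarith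
  calc ‖dodgerPowerSum b T j‖
      ≤ S0j + (j : ℝ) * (T ^ 2 + 1 / 4) ^ (j - 1) * (T + 1 / 4) * (zetaZeroCount T : ℝ) := h1
    _ ≤ (j : ℝ) * (T ^ 2 + 1 / 4) ^ (j - 1) * S01 +
          (j : ℝ) * (T ^ 2 + 1 / 4) ^ (j - 1) * (T + 1 / 4) * (zetaZeroCount T : ℝ) := by linarith
    _ ≤ (j : ℝ) * (T ^ 2 + 1 / 4) ^ (j - 1) * ((dodgerPowerSum b T 1).re + (zetaZeroCount T : ℝ) / 4) +
          (j : ℝ) * (T ^ 2 + 1 / 4) ^ (j - 1) * (T + 1 / 4) * (zetaZeroCount T : ℝ) := by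
        have := mul_le_mul_of_nonneg_left hB hjW
        linarith
    _ = (j : ℝ) * (T ^ 2 + 1 / 4) ^ (j - 1) * ((dodgerPowerSum b T 1).re + (zetaZeroCount T : ℝ) * (T + 1 / 2)) := by
        ring

/-- **The trivial upper bound `p₁ ≤ K·(T²+¼)`** (`Re z_ρ² ≤ ‖z_ρ²‖ ≤ T²+¼`, lattice part `≥ 0`). [this track, ATTEMPT-19 §8 (P4)] -/
theorem re_dodgerPowerSum_one_le_mul {b T : ℝ} :
    (dodgerPowerSum b T 1).re ≤ (zetaZeroCount T : ℝ) * (T ^ 2 + 1 / 4) := by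
  rw [dodgerPowerSum, Complex.sub_re, Complex.re_sum, Complex.re_sum]
  have hz : ∀ ρ ∈ zerosBetween 0 T,
      ((((riemannZetaZeroOrder ρ).toNat : ℂ) * (dodgerNode ρ ^ 2) ^ 1)).re ≤ ((riemannZetaZeroOrder ρ).toNat : ℝ) * (T ^ 2 + 1 / 4) := by
    intro ρ hρ
    obtain ⟨_, h0, h1, him, hle⟩ := (mem_zerosBetween le_rfl).1 hρ
    rw [pow_one, show ((riemannZetaZeroOrder ρ).toNat : ℂ) = (((riemannZetaZeroOrder ρ).toNat : ℝ) : ℂ) by norm_cast,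
      Complex.re_ofReal_mul]
    refine mul_le_mul_of_nonneg_left ((Complex.re_le_norm _).trans (norm_dodgerNode_sq_le h0 h1 him.le hle)) (Nat.cast_nonneg _)
  have hk : ∀ k ∈ Finset.range (zetaZeroCount T),
      0 ≤ (((((π * ((k + 1 : ℕ) : ℝ) / b) ^ 2 : ℝ)) : ℂ) ^ 1).re := by
    intro k _
    rw [pow_one, Complex.ofReal_re]; positivity
  have h1 := Finset.sum_le_sum hz
  rw [← Finset.sum_mul, sum_zeroOrder_toNat_cast_eq] at h1
  have h2 := Finset.sum_nonneg hk
  linarith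

end Summit.RiemannHypothesis.RiemannHypothesis.Theorems.Handoff

end
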